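import Summits.HodgeConjecture.CorCM.NonIsogenousSimpleCMSurfacesHodge
import HarnessLib

/-!
# ANY two simple, non-isogenous CM abelian surfaces: the pair is nondegenerate, and the Hodge conjecture holds on every
# `S₀^a × S₁^b` — the last case (isomorphic cyclic quartic fields carry no separating pair) and the synthesis

COR-CM (cell `pub-hodgecm2`, binder seat `b23` gen 28), count-neutral; NEW as stated, hence under `Summits/`.  The
preceding files settle two simple CM abelian surfaces `S₀`, `S₁` with quartic CM fields `K_{i₀}`, `K_{i₁}`:
`SimpleCMSurfacePairsHodge` (different Galois closures), `QuarticCMReflexPairHodge` (non-isomorphic fields, same closure),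
`NonIsogenousSimpleCMSurfacesHodge` (isomorphic fields, `K_{i₀}` not Galois).  The remaining configuration — isomorphic
CYCLIC Galois quartic fields — carries NO separating pair (`false_of_isCyclic_of_ringEquiv_of_isSeparatingFamily`): in
`Gal(K_{i₀}/ℚ) ≅ C₄` complex conjugation `ρ` is the unique involution, so with `Φ_{i₀} = {a, a∘g}` (`g² = ρ`) and the
pulled-back type `{x, x∘h}` of `K_{i₁}` (`x = a∘δ`, `h ∈ {g, ρg}`) the type of `K_{i₁}` is CM-equivalent to `Φ_{i₀}`
along `e∘δ⁻¹` or `e∘δ⁻¹∘g` — excluded by separation (seat b16's `IsSeparatingFamily.eq_of_forall_mem_iff_comp_mem`).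
Hence, with separation coming from simplicity and non-isogeny (`isSeparatingFamily_of_isSimple_of_pairwise_not_isIsogenous`):

* **`isNondegenerateFamily_simpleSurfaces`** — for ANY two simple, non-isogenous CM abelian surfaces (realisations of
  CM types `Φ_{i₀}`, `Φ_{i₁}` of quartic CM fields) the family `(Φ_{i₀}, Φ_{i₁})` is NONDEGENERATE
  (`rank Hg(S₀ × S₁) = 5`, Moonen–Zarhin);
* **`hodgeConjectureFor_prod_simpleSurfaces`** — the Hodge conjecture and `B• = D•` on every `S₀^a × S₁^b` (every
  `⨁_{j<N} A_{π j}`), UNCONDITIONALLY, with no hypothesis on the fields or the types;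
* `not_exists_exceptional_prod_simpleSurfaces` — no product `S₀^a × S₁^b` carries an exceptional Hodge class.

Theorems only, no definition, no `sorry`.

## References

* [MoonenZarhin1999LowDim] B. Moonen, Yu. Zarhin, Math. Ann. 315 (1999), "Hodge groups of simple abelian surfaces
  of CM-type" (Proposition: `X₁ ≁ X₂` simple CM surfaces ⟹ `Hg(X₁ × X₂) = Hg(X₁) × Hg(X₂)`) and Cor. (3.9).
* [Shimura1998] G. Shimura, *Abelian Varieties with Complex Multiplication and Modular Functions*, §8.4 Example (2).
* [Gordon1999HodgeAVSurvey] B. B. Gordon, *A survey of the Hodge conjecture for abelian varieties*, 7.4–7.5, 10.10.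
-/

noncomputable section

open CategoryTheory CategoryTheory.Limits NumberField NumberField.ComplexEmbedding IntermediateField Module

namespace Summit.HodgeConjecture.CorCM

open Literature.NumberTheory.ComplexMultiplication
open Literature.NumberTheory.ComplexMultiplication.CMTypeOps (mem_iff_conjugate_notMem)
open Literature.AlgebraicGeometry.Motives (AbelianVariety CMType)
open Literature.AlgebraicGeometry.HodgeTheory
open Literature.AlgebraicGeometry.ComplexMultiplication (IsCMTypeRealisation isSimple_iff_isPrimitive)
open Literature.AlgebraicGeometry.VanGeemen1994 (hodgeClassSpan)
open Literature.AlgebraicGeometry.Pohlmann1968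
open Literature.Barriers.HodgeConjecture (divisorClassesSpan)

/-! ### The unique involution of a cyclic group of order `4` -/

section Cyclic

variable {G : Type*} [Group G] [Finite G] [IsCyclic G]

/-- In a cyclic group of order `4` the elements of square `1` are `1` and the unique involution `ρ`. [folklore] -/
private theorem eq_one_or_eq_of_mul_self_eq_one (hG : Nat.card G = 4) {ρ : G} (hρ1 : ρ ≠ 1) (hρ2 : ρ * ρ = 1)
    {k : G} (hk : k * k = 1) : k = 1 ∨ k = ρ := by
  obtain ⟨γ, hγ⟩ := IsCyclic.exists_generator (α := G)
  have hoγ : orderOf γ = 4 := (orderOf_eq_card_of_forall_mem_zpowers hγ).trans hG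
  have key : ∀ k : G, k * k = 1 → k = 1 ∨ k = γ ^ 2 := by
    intro k hk
    obtain ⟨n, rfl⟩ := (Submonoid.mem_powers_iff _ _).1 (mem_powers_iff_mem_zpowers.2 (hγ k))
    have hdvd : 4 ∣ n + n := by
      rw [← hoγ]
      exact orderOf_dvd_of_pow_eq_one (by rw [pow_add]; exact hk)
    have hmod : n % 4 = 0 ∨ n % 4 = 2 := by omega
    rw [← pow_mod_orderOf, hoγ]
    rcases hmod with h | h
    · left; rw [h, pow_zero]
    · right; rw [h]
  rcases key ρ hρ2 with h | h
  · exact absurd h hρ1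
  · rw [h]; exact key k hk

/-- In a cyclic group of order `4` with involution `ρ`, every `k ∉ {1, ρ}` has `k² = ρ`. [folklore] -/
private theorem mul_self_eq_of_ne (hG : Nat.card G = 4) {ρ : G} (hρ1 : ρ ≠ 1) (hρ2 : ρ * ρ = 1) {k : G}
    (hk1 : k ≠ 1) (hkρ : k ≠ ρ) : k * k = ρ := by
  have h4 : (k * k) * (k * k) = 1 := by
    have hk4 : k ^ Nat.card G = 1 := pow_card_eq_one'
    rw [hG] at hk4
    simpa [pow_succ, mul_assoc] using hk4
  rcases eq_one_or_eq_of_mul_self_eq_one hG hρ1 hρ2 h4 with h | h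
  · rcases eq_one_or_eq_of_mul_self_eq_one hG hρ1 hρ2 h with h' | h'
    · exact absurd h' hk1
    · exact absurd h' hkρ
  · exact h

end Cyclic

/-! ### Isomorphic cyclic quartic CM fields carry no separating pair -/

section Fields

variable {I : Type} {K : I → Type} [∀ i, Field (K i)] [∀ i, NumberField (K i)] [∀ i, IsCMField (K i)] [Fintype I]

omit [∀ i, NumberField (K i)] [Fintype I] in
/-- `ū ∘ e = \overline{u ∘ e}`. [folklore] -/
private theorem conjugate_comp' {i₀ i₁ : I} (u : K i₁ →+* ℂ) (e : K i₀ →+* K i₁) :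
    (conjugate u).comp e = conjugate (u.comp e) :=
  RingHom.ext fun x => by rw [RingHom.comp_apply, conjugate_coe_eq, conjugate_coe_eq, RingHom.comp_apply]

omit [Fintype I] in
/-- A separating family has no slot whose type, pulled back along a field isomorphism `e'`, is the type of another
slot: if `Φ_{i₁} = {x, y}` and `x ∘ e', y ∘ e' ∈ Φ_{i₀}` then `i₀ = i₁`. [cite: Gordon1999HodgeAVSurvey, 7.4] -/
private theorem false_of_pullback {i₀ i₁ : I} (h01 : i₀ ≠ i₁) (h4₁ : finrank ℚ (K i₁) = 4) {Φ : ∀ i, CMType (K i)}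
    (hsep : CMAlgebra.IsSeparatingFamily Φ) (e' : K i₀ ≃+* K i₁) {x y : K i₁ →+* ℂ} (hyx : y ≠ x)
    (hyx' : y ≠ conjugate x) (hΦ₁ : ∀ s, s ∈ (Φ i₁).1 ↔ s = x ∨ s = y) (hx : x.comp e'.toRingHom ∈ (Φ i₀).1)
    (hy : y.comp e'.toRingHom ∈ (Φ i₀).1) : False := by
  refine h01 (hsep.eq_of_forall_mem_iff_comp_mem e' fun u => ?_)
  have hnx : (conjugate x).comp e'.toRingHom ∉ (Φ i₀).1 := by
    rw [conjugate_comp']; exact (mem_iff_conjugate_notMem (Φ i₀) _).1 hx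
  have hny : (conjugate y).comp e'.toRingHom ∉ (Φ i₀).1 := by
    rw [conjugate_comp']; exact (mem_iff_conjugate_notMem (Φ i₀) _).1 hy
  have hΦx : x ∈ (Φ i₁).1 := (hΦ₁ x).2 (Or.inl rfl)
  have hΦy : y ∈ (Φ i₁).1 := (hΦ₁ y).2 (Or.inr rfl)
  rcases QuarticCM.eq_or_eq_or_eq_or_eq h4₁ hyx hyx' u with rfl | rfl | rfl | rfl
  · exact iff_of_true hΦx hx
  · exact iff_of_false ((mem_iff_conjugate_notMem (Φ i₁) _).1 hΦx) hnx
  · exact iff_of_true hΦy hy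
  · exact iff_of_false ((mem_iff_conjugate_notMem (Φ i₁) _).1 hΦy) hny

omit [Fintype I] in
/-- **Isomorphic CYCLIC quartic CM fields carry no separating pair of CM types** (two simple CM abelian surfaces with
isomorphic cyclic quartic CM fields are isogenous): in `Gal(K/ℚ) ≅ C₄` the unique involution is `ρ`; writing
`Φ_{i₀} = {a, a∘g}` and the type of `K_{i₁}` pulled back along `e` as `{x, x∘h}` with `x = a∘δ`, one has `g² = h² = ρ`,
so `h = g` or `h = ρg`, and the type of `K_{i₁}` is CM-equivalent to `Φ_{i₀}` along `e∘δ⁻¹` resp. `e∘δ⁻¹∘g`.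
[cite: Shimura1998, §8.4 Example (2)(B)] [cite: Gordon1999HodgeAVSurvey, 7.4] -/
theorem false_of_isCyclic_of_ringEquiv_of_isSeparatingFamily {i₀ i₁ : I} (h01 : i₀ ≠ i₁) [IsGalois ℚ (K i₀)]
    [IsCyclic (K i₀ ≃ₐ[ℚ] K i₀)] (h4₀ : finrank ℚ (K i₀) = 4) (h4₁ : finrank ℚ (K i₁) = 4) (e : K i₀ ≃+* K i₁)
    {Φ : ∀ i, CMType (K i)} (hsep : CMAlgebra.IsSeparatingFamily Φ) : False := by
  classical
  -- the Galois group: cyclic of order `4`, `ρ` its involution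
  have hcard : Nat.card (K i₀ ≃ₐ[ℚ] K i₀) = 4 := by rw [IsGalois.card_aut_eq_finrank, h4₀]
  set ρ : K i₀ ≃ₐ[ℚ] K i₀ := conjGal with hρ
  have hρρ : ρ * ρ = 1 := conjGal_mul_conjGal
  have hcomm : ∀ p q : K i₀ ≃ₐ[ℚ] K i₀, p * q = q * p := fun p q =>
    (IsCyclic.isMulCommutative (α := K i₀ ≃ₐ[ℚ] K i₀)).is_comm.comm p q
  have hρv : ∀ (v : K i₀ →+* ℂ) (z : K i₀), v (ρ z) = conjugate v z := fun v z => by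
    rw [CyclicSextic.conjugate_eq_comp_conjGal]; rfl
  -- slot `i₀`: `Φ_{i₀} = {a, b}`, `b = a ∘ g`
  obtain ⟨a, b, hba, hba', hΦ₀⟩ := QuarticCM.exists_mem_mem_ne h4₀ (Φ i₀)
  have hρ1 : ρ ≠ 1 := by
    intro h
    apply QuarticCM.conjugate_ne a
    refine RingHom.ext fun z => ?_
    rw [← hρv, h, AlgEquiv.one_apply]
  obtain ⟨g, hg⟩ := exists_comp_algEquiv_eq a b
  have pg : ∀ z, a (g z) = b z := fun z => by simpa using RingHom.congr_fun hg z
  have hg1 : g ≠ 1 := by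
    rintro rfl; exact hba (RingHom.ext fun z => by rw [← pg]; rfl)
  have hgρ : g ≠ ρ := by
    rintro h; exact hba' (RingHom.ext fun z => by rw [← pg, h, hρv])
  have hgg : g * g = ρ := mul_self_eq_of_ne hcard hρ1 hρρ hg1 hgρ
  -- slot `i₁`, pulled back along `e`: `{x, y}`, `x = a ∘ δ`, `y = x ∘ h`
  obtain ⟨c', d', hdc, hdc', hΦ₁⟩ := QuarticCM.exists_mem_mem_ne h4₁ (Φ i₁)
  set x : K i₀ →+* ℂ := c'.comp e.toRingHom with hx
  set y : K i₀ →+* ℂ := d'.comp e.toRingHom with hy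
  have hinj : ∀ u u' : K i₁ →+* ℂ, u.comp e.toRingHom = u'.comp e.toRingHom → u = u' := fun u u' h =>
    RingHom.ext fun w => by simpa using RingHom.congr_fun h (e.symm w)
  have hyx : y ≠ x := fun h => hdc (hinj _ _ h)
  have hyx' : y ≠ conjugate x := fun h => hdc' (hinj _ _ (by rw [conjugate_comp']; exact h))
  obtain ⟨δ, hδ⟩ := exists_comp_algEquiv_eq a x
  obtain ⟨h, hh⟩ := exists_comp_algEquiv_eq x y
  have pδ : ∀ z, a (δ z) = x z := fun z => by simpa using RingHom.congr_fun hδ z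
  have ph : ∀ z, x (h z) = y z := fun z => by simpa using RingHom.congr_fun hh z
  have hh1 : h ≠ 1 := by
    rintro rfl; exact hyx (RingHom.ext fun z => by rw [← ph]; rfl)
  have hhρ : h ≠ ρ := by
    rintro h'; exact hyx' (RingHom.ext fun z => by rw [← ph, h', hρv])
  have hhh : h * h = ρ := mul_self_eq_of_ne hcard hρ1 hρρ hh1 hhρ
  -- `h = g` or `h = ρ g`
  have hsq : (h * g⁻¹) * (h * g⁻¹) = 1 := by
    rw [mul_assoc, ← mul_assoc g⁻¹, hcomm g⁻¹ h, mul_assoc, ← mul_assoc, hhh, ← mul_inv_rev, hgg, mul_inv_cancel]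
  have px : ∀ z, x z = c' (e z) := fun z => rfl
  have py : ∀ z, y z = d' (e z) := fun z => rfl
  have pcomm : ∀ (p q : K i₀ ≃ₐ[ℚ] K i₀) (z : K i₀), p (q z) = q (p z) := fun p q z => by
    rw [← AlgEquiv.mul_apply, hcomm, AlgEquiv.mul_apply]
  rcases eq_one_or_eq_of_mul_self_eq_one hcard hρ1 hρρ hsq with h1 | h2
  · -- `h = g`: the type of `K_{i₁}` is `Φ_{i₀}` along `e ∘ δ⁻¹`
    have hhg : h = g := mul_inv_eq_one.1 h1
    let e' : K i₀ ≃+* K i₁ := δ.symm.toRingEquiv.trans e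
    refine false_of_pullback h01 h4₁ hsep e' hdc hdc' hΦ₁ ?_ ?_
    · have : c'.comp e'.toRingHom = a := RingHom.ext fun z => by
        show c' (e (δ.symm z)) = a z
        rw [← px, ← pδ, AlgEquiv.apply_symm_apply]
      rw [this]; exact (hΦ₀ a).2 (Or.inl rfl)
    · have : d'.comp e'.toRingHom = b := RingHom.ext fun z => by
        show d' (e (δ.symm z)) = b z
        rw [← py, ← ph, hhg, pcomm g δ.symm, ← pδ, AlgEquiv.apply_symm_apply, pg]
      rw [this]; exact (hΦ₀ b).2 (Or.inr rfl)
  · -- `h = ρ g`: the type of `K_{i₁}` is `Φ_{i₀}` along `e ∘ δ⁻¹ ∘ g`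
    have hhg : h = ρ * g := mul_inv_eq_iff_eq_mul.1 h2
    let e' : K i₀ ≃+* K i₁ := (g.trans δ.symm).toRingEquiv.trans e
    refine false_of_pullback h01 h4₁ hsep e' hdc hdc' hΦ₁ ?_ ?_
    · have : c'.comp e'.toRingHom = b := RingHom.ext fun z => by
        show c' (e (δ.symm (g z))) = b z
        rw [← px, ← pδ, AlgEquiv.apply_symm_apply, pg]
      rw [this]; exact (hΦ₀ b).2 (Or.inr rfl)
    · have hgg' : ∀ z, g (g z) = ρ z := fun z => by rw [← AlgEquiv.mul_apply, hgg]
      have hρρ' : ∀ z, ρ (ρ z) = z := fun z => by rw [← AlgEquiv.mul_apply, hρρ, AlgEquiv.one_apply]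
      have : d'.comp e'.toRingHom = a := RingHom.ext fun z => by
        show d' (e (δ.symm (g z))) = a z
        rw [← py, ← ph, hhg, AlgEquiv.mul_apply, pcomm g δ.symm, hgg', pcomm ρ δ.symm, hρρ', ← pδ,
          AlgEquiv.apply_symm_apply]
      rw [this]; exact (hΦ₀ a).2 (Or.inl rfl)

end Fields

/-! ### The synthesis: any two simple, non-isogenous CM abelian surfaces -/

section Geometry

variable {I : Type} {K : I → Type} [∀ i, Field (K i)] [∀ i, NumberField (K i)] [∀ i, IsCMField (K i)] [Fintype I]
  [Nonempty I] {Φ : ∀ i, CMType (K i)}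
variable {A : I → AbelianVariety ℂ} {ι : ∀ i, 𝓞 (K i) →+* End (A i)}
  {θ : ∀ i, K i →+* Module.End ℂ (complexBetti (A i).X 1)}

/-- **Any two simple, non-isogenous CM abelian surfaces form a NONDEGENERATE pair** (Moonen–Zarhin:
`Hg(S₀ × S₁) = Hg(S₀) × Hg(S₁)`, rank `5`): realisations `S_i` of CM types `Φ_i` of quartic CM fields `K_i`, `S_i` simple,
`S₀ ≁ S₁` — no hypothesis on the fields.  Cases: `K_{i₀}` not Galois (`NonIsogenousSimpleCMSurfacesHodge`); `K_{i₀}`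
cyclic and `K_{i₁} ≇ K_{i₀}` (different closures, or the reflex-pair theorem); `K_{i₀}` cyclic and `K_{i₁} ≅ K_{i₀}`:
impossible for a separating pair. [cite: MoonenZarhin1999LowDim, "Hodge groups of simple abelian surfaces of CM-type"] -/
theorem isNondegenerateFamily_simpleSurfaces {i₀ i₁ : I} (h01 : i₀ ≠ i₁) (hI : ∀ j, j = i₀ ∨ j = i₁)
    (h4 : ∀ i, finrank ℚ (K i) = 4) (hA : ∀ i, IsCMTypeRealisation (Φ i) (A i) (ι i) (θ i))
    (hS : ∀ i, (A i).IsSimple) (hniso : ∀ i j, i ≠ j → ¬ AbelianVariety.IsIsogenous (A i) (A j)) :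
    CMAlgebra.IsNondegenerateFamily Φ := by
  by_cases hK₀ : IsGalois ℚ (K i₀)
  · have hsep : CMAlgebra.IsSeparatingFamily Φ :=
      CMAlgebra.isSeparatingFamily_of_isSimple_of_pairwise_not_isIsogenous hA hS hniso
    haveI : IsCyclic (K i₀ ≃ₐ[ℚ] K i₀) := QuarticCM.isCyclic_of_isPrimitive (h4 i₀)
      ((isSimple_iff_isPrimitive (hA i₀) (Classical.arbitrary (K i₀ →+* ℂ))).1 (hS i₀))
    by_cases hKK : Nonempty (K i₀ ≃+* K i₁)
    · obtain ⟨e⟩ := hKK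
      exact (false_of_isCyclic_of_ringEquiv_of_isSeparatingFamily h01 (h4 i₀) (h4 i₁) e hsep).elim
    · rw [not_nonempty_iff] at hKK
      by_cases hL : normalClosure ℚ (K i₀) ℂ = normalClosure ℚ (K i₁) ℂ
      · exact isNondegenerateFamily_pair_of_normalClosure_eq_of_isEmpty h01 hI (h4 i₀) (h4 i₁) hL hKK Φ
      · have hreal : ∀ x : ℂ, x ∈ normalClosure ℚ (K i₀) ℂ → x ∈ normalClosure ℚ (K i₁) ℂ →
            starRingEnd ℂ x = x :=
          fun x hx₀ hx₁ => conj_apply_eq_of_mem_inf_of_normalClosure_ne (h4 i₀) (h4 i₁)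
            (not_biquadratic_of_isPrimitive i₀ (h4 i₀)
              ((isSimple_iff_isPrimitive (hA i₀) (Classical.arbitrary (K i₀ →+* ℂ))).1 (hS i₀)))
            (not_biquadratic_of_isPrimitive i₁ (h4 i₁)
              ((isSimple_iff_isPrimitive (hA i₁) (Classical.arbitrary (K i₁ →+* ℂ))).1 (hS i₁))) hL hx₀ hx₁
        refine (isNondegenerateFamily_iff_of_partialConj (forall_exists_partialConj_pair h01 hI hreal) Φ).2
          fun i => ?_
        exact QuarticCM.isNondegenerate_of_isPrimitive (h4 i) (Φ i)
          ((isSimple_iff_isPrimitive (hA i) (Classical.arbitrary (K i →+* ℂ))).1 (hS i))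
  · exact isNondegenerateFamily_simpleSurfaces_of_not_isGalois h01 hI h4 hK₀ hA hS hniso

/-- **The Hodge conjecture for every `S₀^a × S₁^b`, `S₀`, `S₁` ANY two simple non-isogenous CM abelian surfaces** —
every `⨁_{j<N} A_{π j}`, with `Bᵐ ⊗ ℂ = Dᵐ ⊗ ℂ` (all Hodge classes are polynomials in divisor classes), UNCONDITIONALLY
and with no hypothesis on the quartic CM fields or the types. [cite: MoonenZarhin1999LowDim, "Hodge groups of simple abelian surfaces of CM-type" and Cor. (3.9)]
[cite: Gordon1999HodgeAVSurvey, 7.5 and 10.10] -/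
theorem hodgeConjectureFor_prod_simpleSurfaces {i₀ i₁ : I} (h01 : i₀ ≠ i₁) (hI : ∀ j, j = i₀ ∨ j = i₁)
    (h4 : ∀ i, finrank ℚ (K i) = 4) (hA : ∀ i, IsCMTypeRealisation (Φ i) (A i) (ι i) (θ i))
    (hS : ∀ i, (A i).IsSimple) (hniso : ∀ i j, i ≠ j → ¬ AbelianVariety.IsIsogenous (A i) (A j)) {N : ℕ}
    (π : Fin N → I) :
    HodgeConjectureFor (⨁ fun j : Fin N => A (π j)).dim (⨁ fun j : Fin N => A (π j)).X ∧
      ∀ m : ℕ, hodgeClassSpan (⨁ fun j : Fin N => A (π j)).dim (⨁ fun j : Fin N => A (π j)).X m =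
        divisorClassesSpan (⨁ fun j : Fin N => A (π j)).X (⨁ fun j : Fin N => A (π j)).dim m :=
  have hnd := isNondegenerateFamily_simpleSurfaces h01 hI h4 hA hS hniso
  ⟨hnd.hodgeConjectureFor_prod hA π, fun m => hnd.hodgeClassSpan_prod_eq_divisorClassesSpan hA π m⟩

/-- **No product `S₀^a × S₁^b` of two simple non-isogenous CM abelian surfaces carries an exceptional Hodge class.**
[cite: MoonenZarhin1999LowDim, "Hodge groups of simple abelian surfaces of CM-type"] [cite: Gordon1999HodgeAVSurvey, 7.5] -/
theorem not_exists_exceptional_prod_simpleSurfaces {i₀ i₁ : I} (h01 : i₀ ≠ i₁) (hI : ∀ j, j = i₀ ∨ j = i₁)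
    (h4 : ∀ i, finrank ℚ (K i) = 4) (hA : ∀ i, IsCMTypeRealisation (Φ i) (A i) (ι i) (θ i))
    (hS : ∀ i, (A i).IsSimple) (hniso : ∀ i j, i ≠ j → ¬ AbelianVariety.IsIsogenous (A i) (A j)) {N : ℕ}
    (π : Fin N → I) (m : ℕ) :
    ¬ ∃ c : complexBetti (⨁ fun j : Fin N => A (π j)).X (2 * m), IsRationalClass c ∧
        IsOfHodgeType (⨁ fun j : Fin N => A (π j)).dim (⨁ fun j : Fin N => A (π j)).X (2 * m) m m c ∧
        c ∉ divisorClassesSpan (⨁ fun j : Fin N => A (π j)).X (⨁ fun j : Fin N => A (π j)).dim m :=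
  (isNondegenerateFamily_simpleSurfaces h01 hI h4 hA hS hniso).not_exists_exceptional_prod hA π m

end Geometry

end Summit.HodgeConjecture.CorCM

end
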